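import Mathlib
import HarnessLib
import Literature.MathematicalPhysics.StatisticalMechanics.RelevantHamiltonianNorm

/-!
# Lemma 8.8 of [ABKM19] with the `ℓ²(B)` field norm:
# `|H(B)|_{k,B,T_φ} ≤ (1 + |φ|_{k,ℓ²(B)})² ‖H‖_{k,0}`

`RelevantHamiltonianNorm.tayNorm_eval_le` bounds the Taylor norm of a relevant Hamiltonian on a block
by `(1 + ‖T_{B*}φ‖)² ‖H‖_{k,0}` with the SUP gauge of the block neighbourhood.  For the strong norm
`|||·|||_k` of Ch. 9 (weight `W_k^B = e^{½(φ, G_k^B φ)}` built from `Σ_{x ∈ B} |∇^αφ(x)|²`) one needs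
the sharper form of [ABKM19] Lemma 8.8 / (9.x): the field enters only through the `ℓ²(B)` quantities
`‖∇^αφ‖_{ℓ²(B)} = (Σ_{x∈B} |∇^αφ(x)|²)^{1/2}`, by Cauchy–Schwarz over the sites of `B`.  We state it
with an abstract level `N ≥ 0` dominating the normalised `ℓ²` norms,
`‖∇^αφ‖_{ℓ²(B)} ≤ N · √|B| · 𝔥R^{−|α|}` (`α ∈ linIndex`), `‖∇_iφ‖_{ℓ²(B)} ≤ N · √|B| · 𝔥/R` — in the
source `N = |φ|_{k,ℓ²(B)} = h_k^{−1} max_α L^{k(|α|−1)} ‖∇^αφ‖_{ℓ²(B)}`: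

* `tayNorm_linMonomial_le_abs`, `tayNorm_gradMonomial_le_abs` — the pointwise monomial bounds
  `|∇^α(·)(x)|_{T_φ} ≤ |∇^αφ(x)| + 𝔥R^{−|α|}`;
* `sum_abs_le_sqrt_card_mul`, `sum_abs_mul_abs_le` — Cauchy–Schwarz over `B`;
* **`tayNorm_eval_le_of_ell2`** — `|H(B)|_{T_φ} ≤ (1 + N)² ‖H‖_{k,0}`.

Everything is proved; no named fact.

## References
* S. Adams, S. Buchholz, R. Kotecký, S. Müller, arXiv:1910.13564, Lemma 8.8 ((8.51)–(8.53)),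
  Lemma 9.3 (proof) [AdamsBuchholzKoteckyMuller2019].
-/

noncomputable section

namespace Literature.MathematicalPhysics.StatisticalMechanics.GradientRG

open scoped BigOperators
open Finset
open Literature.MathematicalPhysics.StatisticalMechanics.GradientFRD (iterDiff fwdDiff)

variable {𝕜 : Type*} [NormedField 𝕜] [NormedAlgebra ℝ 𝕜] [NormOneClass 𝕜] {d M : ℕ} [NeZero M]

/-! ## Pointwise monomial bounds -/

/-- `|∇^α(·)(x)|_{T_φ} ≤ |∇^αφ(x)| + 𝔥R^{−|α|}` (the Taylor norm of the linear monomial: value plus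
operator norm). [cite: AdamsBuchholzKoteckyMuller2019, App. A.5 (13.29)] -/
theorem tayNorm_linMonomial_le_abs {𝔥 R : ℝ} (h𝔥 : 0 < 𝔥) (hR : 0 < R) {p : ℕ} (hp : d / 2 + 1 ≤ p)
    {S : Finset (Fin d → ZMod M)} {x : Fin d → ZMod M} (hx : x ∈ S) (α : linIndex d) (r₀ : ℕ)
    (φ : (Fin d → ZMod M) → ℝ) :
    tayNorm (fieldGauge 𝔥 R p S) r₀
        (fun ψ : (Fin d → ZMod M) → ℝ => (algebraMap ℝ 𝕜) (iterDiff (α : Fin d → ℕ) ψ x)) φ ≤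
      |iterDiff (α : Fin d → ℕ) φ x| + 𝔥 * (R ^ (∑ i, (α : Fin d → ℕ) i))⁻¹ := by
  set c : ℝ := 𝔥 * (R ^ (∑ i, (α : Fin d → ℕ) i))⁻¹ with hc_def
  have hc : 0 ≤ c := by positivity
  let P : ((Fin d → ZMod M) → ℝ) →ₗ[ℝ] ℝ := (LinearMap.proj x).comp (iterDiffₗ (α : Fin d → ℕ))
  have hPapply : ∀ ξ, P ξ = iterDiff (α : Fin d → ℕ) ξ x := fun ξ => rfl
  have hP : ∀ ξ, ‖P ξ‖ ≤ c * ‖fieldGauge 𝔥 R p S ξ‖ := fun ξ => by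
    rw [hPapply, Real.norm_eq_abs]; exact abs_iterDiff_linIndex_le h𝔥 hR hp hx α ξ
  have h := tayNorm_clm_comp_le (fieldGauge 𝔥 R p S) P hc hP (algebraMapCLM ℝ 𝕜) r₀ φ
  have hg : ‖(algebraMapCLM ℝ 𝕜 : ℝ →L[ℝ] 𝕜)‖ ≤ 1 := by
    refine ContinuousLinearMap.opNorm_le_bound _ zero_le_one fun t => ?_
    rw [one_mul]
    exact le_of_eq (norm_algebraMap' 𝕜 t)
  have hg0 : ‖(algebraMapCLM ℝ 𝕜 : ℝ →L[ℝ] 𝕜) (P φ)‖ = |iterDiff (α : Fin d → ℕ) φ x| := by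
    rw [hPapply]
    exact (norm_algebraMap' 𝕜 _).trans (Real.norm_eq_abs _)
  calc tayNorm (fieldGauge 𝔥 R p S) r₀
        (fun ψ : (Fin d → ZMod M) → ℝ => (algebraMap ℝ 𝕜) (iterDiff (α : Fin d → ℕ) ψ x)) φ
      = tayNorm (fieldGauge 𝔥 R p S) r₀ (fun ψ => (algebraMapCLM ℝ 𝕜 : ℝ →L[ℝ] 𝕜) (P ψ)) φ := rfl
    _ ≤ ‖(algebraMapCLM ℝ 𝕜 : ℝ →L[ℝ] 𝕜) (P φ)‖ + c * ‖(algebraMapCLM ℝ 𝕜 : ℝ →L[ℝ] 𝕜)‖ := h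
    _ ≤ |iterDiff (α : Fin d → ℕ) φ x| + c * 1 := by
        rw [hg0]; exact add_le_add le_rfl (mul_le_mul_of_nonneg_left hg hc)
    _ = |iterDiff (α : Fin d → ℕ) φ x| + c := by ring

/-- `|∇_i(·)(x)|_{T_φ} ≤ |∇_iφ(x)| + 𝔥/R`. [cite: AdamsBuchholzKoteckyMuller2019, App. A.5 (13.29)] -/
theorem tayNorm_gradMonomial_le_abs {𝔥 R : ℝ} (h𝔥 : 0 < 𝔥) (hR : 0 < R) {p : ℕ} (hp : 1 ≤ p)
    {S : Finset (Fin d → ZMod M)} {x : Fin d → ZMod M} (hx : x ∈ S) (i : Fin d) (r₀ : ℕ)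
    (φ : (Fin d → ZMod M) → ℝ) :
    tayNorm (fieldGauge 𝔥 R p S) r₀
        (fun ψ : (Fin d → ZMod M) → ℝ => (algebraMap ℝ 𝕜) (fwdDiff i ψ x)) φ ≤
      |fwdDiff i φ x| + 𝔥 / R := by
  have hc : 0 ≤ 𝔥 / R := div_nonneg h𝔥.le hR.le
  let P : ((Fin d → ZMod M) → ℝ) →ₗ[ℝ] ℝ := (LinearMap.proj i).comp (gradAt x)
  have hPapply : ∀ ξ, P ξ = fwdDiff i ξ x := fun ξ => rfl
  have hPle : ∀ ξ, |fwdDiff i ξ x| ≤ 𝔥 / R * ‖fieldGauge 𝔥 R p S ξ‖ := fun ξ => by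
    have h1 := norm_le_pi_norm (gradAt x ξ) i
    rw [gradAt_apply, Real.norm_eq_abs] at h1
    exact h1.trans (norm_gradAt_le_gauge h𝔥 hR hp hx ξ)
  have hP : ∀ ξ, ‖P ξ‖ ≤ 𝔥 / R * ‖fieldGauge 𝔥 R p S ξ‖ := fun ξ => by
    rw [hPapply, Real.norm_eq_abs]; exact hPle ξ
  have h := tayNorm_clm_comp_le (fieldGauge 𝔥 R p S) P hc hP (algebraMapCLM ℝ 𝕜) r₀ φ
  have hg : ‖(algebraMapCLM ℝ 𝕜 : ℝ →L[ℝ] 𝕜)‖ ≤ 1 := by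
    refine ContinuousLinearMap.opNorm_le_bound _ zero_le_one fun t => ?_
    rw [one_mul]
    exact le_of_eq (norm_algebraMap' 𝕜 t)
  have hg0 : ‖(algebraMapCLM ℝ 𝕜 : ℝ →L[ℝ] 𝕜) (P φ)‖ = |fwdDiff i φ x| := by
    rw [hPapply]
    exact (norm_algebraMap' 𝕜 _).trans (Real.norm_eq_abs _)
  calc tayNorm (fieldGauge 𝔥 R p S) r₀
        (fun ψ : (Fin d → ZMod M) → ℝ => (algebraMap ℝ 𝕜) (fwdDiff i ψ x)) φ
      = tayNorm (fieldGauge 𝔥 R p S) r₀ (fun ψ => (algebraMapCLM ℝ 𝕜 : ℝ →L[ℝ] 𝕜) (P ψ)) φ := rfl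
    _ ≤ ‖(algebraMapCLM ℝ 𝕜 : ℝ →L[ℝ] 𝕜) (P φ)‖ + 𝔥 / R * ‖(algebraMapCLM ℝ 𝕜 : ℝ →L[ℝ] 𝕜)‖ := h
    _ ≤ |fwdDiff i φ x| + 𝔥 / R * 1 := by
        rw [hg0]; exact add_le_add le_rfl (mul_le_mul_of_nonneg_left hg hc)
    _ = |fwdDiff i φ x| + 𝔥 / R := by ring

/-! ## Cauchy–Schwarz over the sites of `B` -/

omit [NeZero M] in
/-- `Σ_{x∈B} |f(x)| ≤ √|B| · ‖f‖_{ℓ²(B)}`. [cite: AdamsBuchholzKoteckyMuller2019, Lemma 8.8 (proof, Cauchy–Schwarz)] -/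
theorem sum_abs_le_sqrt_card_mul (B : Finset (Fin d → ZMod M)) (f : (Fin d → ZMod M) → ℝ) :
    ∑ x ∈ B, |f x| ≤ Real.sqrt B.card * Real.sqrt (∑ x ∈ B, f x ^ 2) := by
  have h := Real.sum_mul_le_sqrt_mul_sqrt B (fun _ => (1 : ℝ)) (fun x => |f x|)
  simp only [one_mul, one_pow, Finset.sum_const, nsmul_eq_mul, mul_one, sq_abs] at h
  exact h

omit [NeZero M] in
/-- `Σ_{x∈B} |f(x)||g(x)| ≤ ‖f‖_{ℓ²(B)} ‖g‖_{ℓ²(B)}`. [cite: AdamsBuchholzKoteckyMuller2019, Lemma 8.8 (proof, Cauchy–Schwarz)] -/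
theorem sum_abs_mul_abs_le (B : Finset (Fin d → ZMod M)) (f g : (Fin d → ZMod M) → ℝ) :
    ∑ x ∈ B, |f x| * |g x| ≤ Real.sqrt (∑ x ∈ B, f x ^ 2) * Real.sqrt (∑ x ∈ B, g x ^ 2) := by
  have h := Real.sum_mul_le_sqrt_mul_sqrt B (fun x => |f x|) (fun x => |g x|)
  simp only [sq_abs] at h
  exact h

/-! ## Lemma 8.8 with the `ℓ²` field norm -/

/-- **[ABKM19] Lemma 8.8, `ℓ²(B)` form: `|H(B)|_{T_φ} ≤ (1 + N)² ‖H‖_{k,0}`** whenever `N ≥ 0`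
dominates the normalised `ℓ²(B)` norms of the field, `‖∇^αφ‖_{ℓ²(B)} ≤ N √|B| 𝔥R^{−|α|}` for
`α ∈ linIndex d` and `‖∇_iφ‖_{ℓ²(B)} ≤ N √|B| 𝔥/R` for every direction `i` (gauge `T = fieldGauge 𝔥 R p S`,
`B ⊆ S`, `p ≥ ⌊d/2⌋ + 1`).  In the source `N = |φ|_{k,ℓ²(B)}`.
[cite: AdamsBuchholzKoteckyMuller2019, Lemma 8.8] -/
theorem tayNorm_eval_le_of_ell2 {𝔥 R : ℝ} (h𝔥 : 0 < 𝔥) (hR : 0 < R) {p : ℕ} (hp : d / 2 + 1 ≤ p)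
    {S B : Finset (Fin d → ZMod M)} (hBS : B ⊆ S) (H : RelevantHamiltonian 𝕜 d) (r₀ : ℕ)
    (φ : (Fin d → ZMod M) → ℝ) {N : ℝ} (hN0 : 0 ≤ N)
    (hNlin : ∀ α : linIndex d, Real.sqrt (∑ x ∈ B, (iterDiff (α : Fin d → ℕ) φ x) ^ 2) ≤
      N * (Real.sqrt B.card * (𝔥 * (R ^ (∑ i, (α : Fin d → ℕ) i))⁻¹)))
    (hNgrad : ∀ i : Fin d, Real.sqrt (∑ x ∈ B, (fwdDiff i φ x) ^ 2) ≤ N * (Real.sqrt B.card * (𝔥 / R))) :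
    tayNorm (fieldGauge 𝔥 R p S) r₀ (fun ψ : (Fin d → ZMod M) → ℝ => eval H B ψ) φ ≤
      (1 + N) ^ 2 * hamNorm 𝔥 R B.card H := by
  have hp1 : 1 ≤ p := le_trans (Nat.le_add_left 1 _) hp
  set T := fieldGauge 𝔥 R p S with hT
  set n : ℝ := (B.card : ℝ) with hn
  have hn0 : 0 ≤ n := Nat.cast_nonneg _
  have hsqn : Real.sqrt n * Real.sqrt n = n := Real.mul_self_sqrt hn0
  -- smoothness of the monomials
  have hlinCD : ∀ (α : Fin d → ℕ) (x : Fin d → ZMod M), ContDiff ℝ r₀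
      (fun ψ : (Fin d → ZMod M) → ℝ => (algebraMap ℝ 𝕜) (iterDiff α ψ x)) := by
    intro α x
    have : (fun ψ : (Fin d → ZMod M) → ℝ => (algebraMap ℝ 𝕜) (iterDiff α ψ x)) =
        fun ψ => (algebraMapCLM ℝ 𝕜 : ℝ →L[ℝ] 𝕜)
          (LinearMap.toContinuousLinearMap ((LinearMap.proj x).comp (iterDiffₗ (M := M) α)) ψ) := rfl
    rw [this]
    exact (algebraMapCLM ℝ 𝕜).contDiff.comp (ContinuousLinearMap.contDiff _)
  have hgradCD : ∀ (i : Fin d) (x : Fin d → ZMod M), ContDiff ℝ r₀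
      (fun ψ : (Fin d → ZMod M) → ℝ => (algebraMap ℝ 𝕜) (fwdDiff i ψ x)) := by
    intro i x
    have : (fun ψ : (Fin d → ZMod M) → ℝ => (algebraMap ℝ 𝕜) (fwdDiff i ψ x)) =
        fun ψ => (algebraMapCLM ℝ 𝕜 : ℝ →L[ℝ] 𝕜)
          (LinearMap.toContinuousLinearMap ((LinearMap.proj i).comp (gradAt (M := M) x)) ψ) := rfl
    rw [this]
    exact (algebraMapCLM ℝ 𝕜).contDiff.comp (ContinuousLinearMap.contDiff _)
  -- abbreviations for the pointwise field quantities
  set la : linIndex d → (Fin d → ZMod M) → ℝ := fun α x => |iterDiff (α : Fin d → ℕ) φ x| with hla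
  set ga : Fin d → (Fin d → ZMod M) → ℝ := fun i x => |fwdDiff i φ x| with hga
  set cl : linIndex d → ℝ := fun α => 𝔥 * (R ^ (∑ i, (α : Fin d → ℕ) i))⁻¹ with hcl
  set cg : ℝ := 𝔥 / R with hcg
  have hcl0 : ∀ α, 0 ≤ cl α := fun α => by positivity
  have hcg0 : 0 ≤ cg := div_nonneg h𝔥.le hR.le
  -- the site bound: density at `x` ≤ ‖a_∅‖ + Σ_α (|∇^αφ(x)| + c_α)‖a_α‖ + Σ_q (|∇_iφ(x)|+c)(|∇_jφ(x)|+c)‖a_q‖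
  have hsite : ∀ x ∈ B, tayNorm T r₀ (fun ψ : (Fin d → ZMod M) → ℝ => density H ψ x) φ ≤
      ‖H (Sum.inl ())‖ + ∑ α : linIndex d, (la α x + cl α) * ‖H (Sum.inr (Sum.inl α))‖ +
        ∑ q : quadIndex d, (ga q.1.1 x + cg) * (ga q.1.2 x + cg) * ‖H (Sum.inr (Sum.inr q))‖ := by
    intro x hx
    have hxS : x ∈ S := hBS hx
    have hterm : ∀ ι : RelIndex d, (fun ψ : (Fin d → ZMod M) → ℝ => relMonomial ι ψ x • H ι) =
        fun ψ => (algebraMap ℝ 𝕜) (relMonomial ι ψ x) * H ι := by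
      intro ι; funext ψ; exact Algebra.smul_def _ _
    have hmonoCD : ∀ ι : RelIndex d, ContDiff ℝ r₀
        (fun ψ : (Fin d → ZMod M) → ℝ => (algebraMap ℝ 𝕜) (relMonomial ι ψ x)) := by
      rintro (u | α | q)
      · simp only [relMonomial_const, map_one]; exact contDiff_const
      · simp only [relMonomial_lin]; exact hlinCD _ x
      · simp only [relMonomial_quad, map_mul]; exact (hgradCD _ x).mul (hgradCD _ x)
    have htermCD : ∀ ι : RelIndex d, ContDiff ℝ r₀
        (fun ψ : (Fin d → ZMod M) → ℝ => relMonomial ι ψ x • H ι) := by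
      intro ι; rw [hterm]; exact (hmonoCD ι).mul contDiff_const
    have hmono : ∀ ι : RelIndex d,
        tayNorm T r₀ (fun ψ : (Fin d → ZMod M) → ℝ => relMonomial ι ψ x • H ι) φ ≤
        (match ι with
          | Sum.inl _ => ‖H ι‖
          | Sum.inr (Sum.inl α) => (la α x + cl α) * ‖H ι‖
          | Sum.inr (Sum.inr q) => (ga q.1.1 x + cg) * (ga q.1.2 x + cg) * ‖H ι‖) := by
      rintro (u | α | q)
      · simp only [relMonomial_const, one_smul]
        rw [tayNorm_const]
      · rw [hterm]
        refine (tayNorm_mul_const_le T (hmonoCD _) _ φ).trans ?_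
        simp only [relMonomial_lin]
        exact mul_le_mul_of_nonneg_right (tayNorm_linMonomial_le_abs (𝕜 := 𝕜) h𝔥 hR hp hxS α r₀ φ)
          (norm_nonneg _)
      · rw [hterm]
        refine (tayNorm_mul_const_le T (hmonoCD _) _ φ).trans ?_
        simp only [relMonomial_quad, map_mul]
        have hb1 := tayNorm_gradMonomial_le_abs (𝕜 := 𝕜) h𝔥 hR hp1 hxS q.1.1 r₀ φ
        have hb2 := tayNorm_gradMonomial_le_abs (𝕜 := 𝕜) h𝔥 hR hp1 hxS q.1.2 r₀ φ
        have hprod := tayNorm_mul_le T (hgradCD q.1.1 x) (hgradCD q.1.2 x) φ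
        have hA : 0 ≤ tayNorm T r₀ (fun ψ : (Fin d → ZMod M) → ℝ =>
            (algebraMap ℝ 𝕜) (fwdDiff q.1.1 ψ x)) φ := tayNorm_nonneg _ _ _ _
        have hB : 0 ≤ tayNorm T r₀ (fun ψ : (Fin d → ZMod M) → ℝ =>
            (algebraMap ℝ 𝕜) (fwdDiff q.1.2 ψ x)) φ := tayNorm_nonneg _ _ _ _
        refine mul_le_mul_of_nonneg_right (hprod.trans (mul_le_mul hb1 hb2 hB ?_)) (norm_nonneg _)
        exact hA.trans hb1
    calc tayNorm T r₀ (fun ψ : (Fin d → ZMod M) → ℝ => density H ψ x) φ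
        = tayNorm T r₀ (fun ψ => ∑ ι : RelIndex d, relMonomial ι ψ x • H ι) φ := rfl
      _ ≤ ∑ ι : RelIndex d, tayNorm T r₀ (fun ψ => relMonomial ι ψ x • H ι) φ :=
          tayNorm_sum_le T Finset.univ (fun ι _ => htermCD ι) φ
      _ ≤ ∑ ι : RelIndex d, (match ι with
          | Sum.inl _ => ‖H ι‖
          | Sum.inr (Sum.inl α) => (la α x + cl α) * ‖H ι‖
          | Sum.inr (Sum.inr q) => (ga q.1.1 x + cg) * (ga q.1.2 x + cg) * ‖H ι‖) :=
          Finset.sum_le_sum fun ι _ => hmono ι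
      _ = ‖H (Sum.inl ())‖ + ∑ α : linIndex d, (la α x + cl α) * ‖H (Sum.inr (Sum.inl α))‖ +
          ∑ q : quadIndex d, (ga q.1.1 x + cg) * (ga q.1.2 x + cg) * ‖H (Sum.inr (Sum.inr q))‖ := by
          simp only [Fintype.sum_sum_type, Fintype.sum_unique, PUnit.default_eq_unit]
          rw [add_assoc]
  -- summing the site bounds over `B` with Cauchy–Schwarz
  have hL2lin : ∀ α : linIndex d, ∑ x ∈ B, la α x ≤ N * (n * cl α) := by
    intro α
    calc ∑ x ∈ B, la α x ≤ Real.sqrt n * Real.sqrt (∑ x ∈ B, (iterDiff (α : Fin d → ℕ) φ x) ^ 2) :=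
          sum_abs_le_sqrt_card_mul B _
      _ ≤ Real.sqrt n * (N * (Real.sqrt n * cl α)) :=
          mul_le_mul_of_nonneg_left (hNlin α) (Real.sqrt_nonneg _)
      _ = N * (Real.sqrt n * Real.sqrt n * cl α) := by ring
      _ = N * (n * cl α) := by rw [hsqn]
  have hL2grad : ∀ i : Fin d, ∑ x ∈ B, ga i x ≤ N * (n * cg) := by
    intro i
    calc ∑ x ∈ B, ga i x ≤ Real.sqrt n * Real.sqrt (∑ x ∈ B, (fwdDiff i φ x) ^ 2) :=
          sum_abs_le_sqrt_card_mul B _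
      _ ≤ Real.sqrt n * (N * (Real.sqrt n * cg)) :=
          mul_le_mul_of_nonneg_left (hNgrad i) (Real.sqrt_nonneg _)
      _ = N * (Real.sqrt n * Real.sqrt n * cg) := by ring
      _ = N * (n * cg) := by rw [hsqn]
  have hL2quad : ∀ i j : Fin d, ∑ x ∈ B, ga i x * ga j x ≤ N ^ 2 * (n * cg ^ 2) := by
    intro i j
    calc ∑ x ∈ B, ga i x * ga j x
        ≤ Real.sqrt (∑ x ∈ B, (fwdDiff i φ x) ^ 2) * Real.sqrt (∑ x ∈ B, (fwdDiff j φ x) ^ 2) :=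
          sum_abs_mul_abs_le B _ _
      _ ≤ (N * (Real.sqrt n * cg)) * (N * (Real.sqrt n * cg)) :=
          mul_le_mul (hNgrad i) (hNgrad j) (Real.sqrt_nonneg _) (by positivity)
      _ = N ^ 2 * (Real.sqrt n * Real.sqrt n * cg ^ 2) := by ring
      _ = N ^ 2 * (n * cg ^ 2) := by rw [hsqn]
  -- the three blocks after summation
  have hconst : ∑ x ∈ B, ‖H (Sum.inl ())‖ = n * ‖H (Sum.inl ())‖ := by
    rw [Finset.sum_const, nsmul_eq_mul]
  have hlin : ∑ x ∈ B, ∑ α : linIndex d, (la α x + cl α) * ‖H (Sum.inr (Sum.inl α))‖ ≤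
      (1 + N) * (n * ∑ α : linIndex d, cl α * ‖H (Sum.inr (Sum.inl α))‖) := by
    rw [Finset.sum_comm, Finset.mul_sum, Finset.mul_sum]
    refine Finset.sum_le_sum fun α _ => ?_
    have hHα : 0 ≤ ‖H (Sum.inr (Sum.inl α))‖ := norm_nonneg _
    rw [← Finset.sum_mul, Finset.sum_add_distrib, Finset.sum_const, nsmul_eq_mul]
    calc (∑ x ∈ B, la α x + n * cl α) * ‖H (Sum.inr (Sum.inl α))‖
        ≤ (N * (n * cl α) + n * cl α) * ‖H (Sum.inr (Sum.inl α))‖ :=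
          mul_le_mul_of_nonneg_right (add_le_add (hL2lin α) le_rfl) hHα
      _ = (1 + N) * (n * (cl α * ‖H (Sum.inr (Sum.inl α))‖)) := by ring
  have hquad : ∑ x ∈ B, ∑ q : quadIndex d, (ga q.1.1 x + cg) * (ga q.1.2 x + cg) * ‖H (Sum.inr (Sum.inr q))‖ ≤
      (1 + N) ^ 2 * (n * ∑ q : quadIndex d, cg ^ 2 * ‖H (Sum.inr (Sum.inr q))‖) := by
    rw [Finset.sum_comm, Finset.mul_sum, Finset.mul_sum]
    refine Finset.sum_le_sum fun q _ => ?_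
    have hHq : 0 ≤ ‖H (Sum.inr (Sum.inr q))‖ := norm_nonneg _
    rw [← Finset.sum_mul]
    have hexp : ∑ x ∈ B, (ga q.1.1 x + cg) * (ga q.1.2 x + cg) =
        ∑ x ∈ B, ga q.1.1 x * ga q.1.2 x + cg * ∑ x ∈ B, ga q.1.1 x + cg * ∑ x ∈ B, ga q.1.2 x +
          n * cg ^ 2 := by
      rw [Finset.mul_sum, Finset.mul_sum, ← Finset.sum_add_distrib, ← Finset.sum_add_distrib]
      have : (n * cg ^ 2) = ∑ x ∈ B, cg ^ 2 := by rw [Finset.sum_const, nsmul_eq_mul]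
      rw [this, ← Finset.sum_add_distrib]
      exact Finset.sum_congr rfl fun x _ => by ring
    rw [hexp]
    have h1 := hL2quad q.1.1 q.1.2
    have h2 := mul_le_mul_of_nonneg_left (hL2grad q.1.1) hcg0
    have h3 := mul_le_mul_of_nonneg_left (hL2grad q.1.2) hcg0
    calc (∑ x ∈ B, ga q.1.1 x * ga q.1.2 x + cg * ∑ x ∈ B, ga q.1.1 x + cg * ∑ x ∈ B, ga q.1.2 x +
          n * cg ^ 2) * ‖H (Sum.inr (Sum.inr q))‖
        ≤ (N ^ 2 * (n * cg ^ 2) + cg * (N * (n * cg)) + cg * (N * (n * cg)) + n * cg ^ 2) *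
            ‖H (Sum.inr (Sum.inr q))‖ :=
          mul_le_mul_of_nonneg_right (by linarith) hHq
      _ = (1 + N) ^ 2 * (n * (cg ^ 2 * ‖H (Sum.inr (Sum.inr q))‖)) := by ring
  -- assemble
  have hdensCD : ∀ x ∈ B, ContDiff ℝ r₀ (fun ψ : (Fin d → ZMod M) → ℝ => density H ψ x) := by
    intro x _
    refine ContDiff.sum fun ι _ => ?_
    have : (fun ψ : (Fin d → ZMod M) → ℝ => relMonomial ι ψ x • H ι) =
        fun ψ => (algebraMap ℝ 𝕜) (relMonomial ι ψ x) * H ι := by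
      funext ψ; exact Algebra.smul_def _ _
    rw [this]
    refine ContDiff.mul ?_ contDiff_const
    rcases ι with (u | α | q)
    · simp only [relMonomial_const, map_one]; exact contDiff_const
    · simp only [relMonomial_lin]; exact hlinCD _ x
    · simp only [relMonomial_quad, map_mul]; exact (hgradCD _ x).mul (hgradCD _ x)
  have h1N : 1 ≤ 1 + N := le_add_of_nonneg_right hN0
  have hc0 : 0 ≤ n * ‖H (Sum.inl ())‖ := mul_nonneg hn0 (norm_nonneg _)
  have hl0 : 0 ≤ n * ∑ α : linIndex d, cl α * ‖H (Sum.inr (Sum.inl α))‖ :=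
    mul_nonneg hn0 (Finset.sum_nonneg fun α _ => mul_nonneg (hcl0 α) (norm_nonneg _))
  calc tayNorm T r₀ (fun ψ : (Fin d → ZMod M) → ℝ => eval H B ψ) φ
      = tayNorm T r₀ (fun ψ => ∑ x ∈ B, density H ψ x) φ := rfl
    _ ≤ ∑ x ∈ B, tayNorm T r₀ (fun ψ : (Fin d → ZMod M) → ℝ => density H ψ x) φ :=
        tayNorm_sum_le T B hdensCD φ
    _ ≤ ∑ x ∈ B, (‖H (Sum.inl ())‖ + ∑ α : linIndex d, (la α x + cl α) * ‖H (Sum.inr (Sum.inl α))‖ +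
        ∑ q : quadIndex d, (ga q.1.1 x + cg) * (ga q.1.2 x + cg) * ‖H (Sum.inr (Sum.inr q))‖) :=
        Finset.sum_le_sum hsite
    _ = n * ‖H (Sum.inl ())‖ +
          ∑ x ∈ B, ∑ α : linIndex d, (la α x + cl α) * ‖H (Sum.inr (Sum.inl α))‖ +
          ∑ x ∈ B, ∑ q : quadIndex d, (ga q.1.1 x + cg) * (ga q.1.2 x + cg) * ‖H (Sum.inr (Sum.inr q))‖ := by
        rw [Finset.sum_add_distrib, Finset.sum_add_distrib, hconst]
    _ ≤ (1 + N) ^ 2 * (n * ‖H (Sum.inl ())‖) +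
          (1 + N) ^ 2 * (n * ∑ α : linIndex d, cl α * ‖H (Sum.inr (Sum.inl α))‖) +
          (1 + N) ^ 2 * (n * ∑ q : quadIndex d, cg ^ 2 * ‖H (Sum.inr (Sum.inr q))‖) := by
        refine add_le_add (add_le_add ?_ (hlin.trans ?_)) hquad
        · exact le_mul_of_one_le_left hc0 (one_le_pow₀ h1N)
        · have : (1 + N) ≤ (1 + N) ^ 2 := by nlinarith
          exact mul_le_mul_of_nonneg_right this hl0
    _ = (1 + N) ^ 2 * hamNorm 𝔥 R B.card H := by
        rw [hamNorm, ← hn]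
        simp only [hcl, hcg]
        ring

end Literature.MathematicalPhysics.StatisticalMechanics.GradientRG

end
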